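import Literature.Computability.QuantumComplexity.SimonRestrictedWeight
import Literature.Computability.Complexity.SipserCodingLemma
import Mathlib.Analysis.Convex.SpecificFunctions.Basic
import HarnessLib

/-!
# Restricted-weight Simon: the ideal quantum player's number of runs (Theorem 2, upper bound)

Topic `Literature/Computability/QuantumComplexity`, companion of `SimonRestrictedWeight.lean`
(the classical benchmark, Theorem 1 and eqs. (3)–(5)).  Source: P. Singkanipa, V. Kasatkin,
Z. Zhou, G. Quiroz, D. A. Lidar, *Demonstration of algorithmic quantum speedup for an Abelian hidden
subgroup problem*, Phys. Rev. X **15**, 021082 (2025) = arXiv:2401.07934 [SingkanipaEtAl2025]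
(held text `paper:arxiv-2401.07934`), §III.B (p. 4: “Each execution of the circuit produces a
uniformly random z such that b⋅z = 0 … we need the NTS for an optimal, ideal quantum player
executing the circuit in Fig. 1 until b ∈ S can be uniquely determined, which we denote by NTS_IQ”),
**Theorem 2**, eq. (6) (“If |S| = 1 then NTS_IQ = 0. If |S| ≥ 2 then
log₂|S| ≤ NTS_IQ ≤ log₂(|S| − 1) + 2”) and its proof, Appendix F (p. 16): “let b* be the true
(hidden) value of b and let S* = S ∖ {b*}. For each b ∈ S* let X_b be the random variable
representing the number of circuit executions needed to learn that b* ≠ b. Since upon each circuit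
execution z is uniformly distributed among all z s.t. b⋅z* = 0, we know that X_b is geometrically
distributed: Pr(X_b = k) = 2^{−k} for k ≥ 1. Let X_max = max_{b∈S*} X_b. Then
Pr(X_max = k) ≤ Σ_{b∈S*} Pr(X_b = k) = (|S| − 1)2^{−k} (F1), which implies
Pr(X_max ≥ k) ≤ (|S| − 1)2^{1−k}. Now, let a = ⌊log₂(|S| − 1)⌋ and let b be the fractional part of
log₂(|S| − 1) so that |S| − 1 = 2^{a+b}. We have:
NTS_IQ = E[X_max] = Σ_{k=1}^{∞} Pr(X_max ≥ k) ≤ Σ_{k=1}^{∞} min(1, 2^{a+b+1−k}) = a + 1 + 2^b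
… ≤ log₂(|S| − 1) + 2 (F2)”.

HONEST FRAMING (pub-qadeq lane context, CLAIMS rows E-30 / E-41 — “we demonstrate an exponential
speedup, albeit of a lower quality than the speedup predicted for the noiseless algorithm”: the
noiseless prediction is this Theorem 2): instance-level adjudication of specific advantage claims;
no claim about BQP vs BPP or the summit.  This file formalises the COMBINATORIAL content of the
upper bound in (6): the run outcomes of the ideal circuit are modelled, exactly as the paper does,
as independent uniform draws from `{z : b*⋅z = 0}` — the uniform law on the k-fold product of that
set; no quantum circuit, amplitude or device is formalised here (the tree's Simon-circuit analysis
is elsewhere), and the entropy lower bound `log₂|S| ≤ NTS_IQ` of (6) is NOT formalised.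

## Contents (all proved, 0 named facts; `Bits n`, `bxor` from `SimonQueryBound.lean`, the GF(2)
   inner product `dotZ` from `SipserCodingLemma.lean`)

* `outcomes b*` — the measurement outcomes `{z : z⋅b* = 0}` of one run; `two_mul_card_outcomes`
  (`2·|outcomes| = 2ⁿ` for `b* ≠ 0ⁿ`); `survivors b* b` — the outcomes that do NOT yet exclude the
  wrong candidate `b` (`z⋅b = 0`); **`two_mul_card_survivors`** — exactly half of the outcomes
  exclude `b` (for `b ∉ {0ⁿ, b*}`; the translation `z ↦ z ⊕ w` by a `w` with `w⋅b* = 0`, `w⋅b = 1`),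
  i.e. “X_b is geometrically distributed: Pr(X_b = k) = 2^{−k}”.
* `runs b* k` — the sample space of `k` runs (`Fintype.piFinset`), `alive`, `someAlive`
  (`X_max > k`); `two_pow_mul_card_filter_alive` (`2^k · |{b alive after k runs}| = |runs|`) and
  **`two_pow_mul_card_filter_someAlive_le`** — display (F1) summed into the tail bound
  `2^k · |{X_max > k}| ≤ (|S| − 1) · |runs|`, i.e. `Pr(X_max > k) ≤ (|S|−1) 2^{−k}`.
* `tailProb` (`Pr(X_max > k)` as a real number), `tailProb_le_one`, `tailProb_le`;
  `sum_min_one_div_two_pow_le` — the analytic step of (F2):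
  `Σ_{k<K} min(1, m 2^{−k}) ≤ log₂ m + 2` for every `K` (`a + 1 + 2^b ≤ log₂ m + 2` via Bernoulli);
  **`sum_tailProb_le`** — for every horizon `K`, `Σ_{k<K} Pr(X_max > k) ≤ log₂(|S| − 1) + 2`;
  since `NTS_IQ = E[X_max] = Σ_{k≥0} Pr(X_max > k)` (the tail-sum formula the proof uses as
  `Σ_{k≥1} Pr(X_max ≥ k)`), every partial sum of that series, hence `NTS_IQ`, is at most
  `log₂(|S| − 1) + 2` — the upper bound of eq. (6).
-/

noncomputable section

namespace Literature.Computability.QuantumComplexity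

namespace SimonLB

open Finset Literature.Computability.Complexity.SipserHash

variable {n : ℕ}

/-! ## One run of the ideal circuit: outcomes `z` with `z⋅b* = 0`, and the candidates they exclude -/

/-- `⟨r, 0ⁿ⟩ = 0`. [folklore] -/
private theorem dotZ_zero_right (r : Bits n) : dotZ r (fun _ => false) = 0 := by
  simp [dotZ]

/-- `⟨x ⊕ w, y⟩ = ⟨x, y⟩ + ⟨w, y⟩` over GF(2). [folklore] -/
private theorem dotZ_bxor_left (x w y : Bits n) : dotZ (bxor x w) y = dotZ x y + dotZ w y := by
  unfold dotZ bxor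
  rw [← sum_add_distrib]
  refine sum_congr rfl fun c _ => ?_
  cases x c <;> cases w c <;> cases y c <;> decide

/-- The single-coordinate vector `e_c`. [folklore] -/
private def unitVec (c : Fin n) : Bits n := fun i => decide (i = c)

/-- `⟨e_c, y⟩ = y_c`. [folklore] -/
private theorem dotZ_unitVec (c : Fin n) (y : Bits n) :
    dotZ (unitVec c) y = if y c then 1 else 0 := by
  unfold dotZ unitVec
  rw [← sum_erase_add _ _ (mem_univ c)]
  rw [sum_eq_zero fun i hi => by rw [mem_erase] at hi; simp [hi.1]]
  simp

/-- For a wrong nonzero candidate `b ≠ b*` there is a translation vector `w` with `w⋅b* = 0` and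
`w⋅b = 1` (so `z ↦ z ⊕ w` preserves the outcome set and flips `z⋅b`). [folklore] -/
private theorem exists_dotZ_eq (b bstar : Bits n) (hb0 : b ≠ fun _ => false) (hbs : b ≠ bstar) :
    ∃ w : Bits n, dotZ w bstar = 0 ∧ dotZ w b = 1 := by
  by_cases h : ∃ c, b c = true ∧ bstar c = false
  · obtain ⟨c, hbc, hsc⟩ := h
    exact ⟨unitVec c, by rw [dotZ_unitVec]; simp [hsc], by rw [dotZ_unitVec]; simp [hbc]⟩
  · push Not at h
    -- supp b ⊆ supp b*: pick c with b_c = 1 (b ≠ 0) and c' with b*_{c'} = 1, b_{c'} = 0 (b ≠ b*)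
    obtain ⟨c, hc⟩ : ∃ c, b c = true := by
      by_contra hno
      push Not at hno
      exact hb0 (funext fun i => by simpa using hno i)
    have hsc : bstar c = true := by
      have := h c hc
      simpa using this
    obtain ⟨c', hc'⟩ : ∃ c', b c' ≠ bstar c' := Function.ne_iff.1 hbs
    have hb' : b c' = false := by
      cases hbc' : b c' with
      | false => rfl
      | true =>
        have := h c' hbc'
        rw [hbc'] at hc'
        exact absurd this.symm (by simpa using hc')
    have hs' : bstar c' = true := by
      rw [hb'] at hc'
      simpa using (Ne.symm hc')
    have hcc' : c ≠ c' := by rintro rfl; rw [hc] at hb'; exact Bool.noConfusion hb'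
    refine ⟨bxor (unitVec c) (unitVec c'), ?_, ?_⟩
    · rw [dotZ_bxor_left, dotZ_unitVec, dotZ_unitVec, if_pos hsc, if_pos hs']
      decide
    · rw [dotZ_bxor_left, dotZ_unitVec, dotZ_unitVec, if_pos hc]
      simp [hb']

/-- The outcomes of one execution of the ideal circuit with hidden mask `b*`: the bit strings `z`
with `z⋅b* = 0` (“Each execution of the circuit produces a uniformly random z such that b⋅z = 0”).
[cite: SingkanipaEtAl2025, §III.B and App. E eq. (E4c)] -/
def outcomes (bstar : Bits n) : Finset (Bits n) := univ.filter fun z => dotZ z bstar = 0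

/-- For `b* ≠ 0ⁿ` exactly half of all bit strings are outcomes: `2 · |{z : z⋅b* = 0}| = 2ⁿ`.
[cite: SingkanipaEtAl2025, App. E eq. (E4c) (the sum over {z ∣ z⋅b = 0} with normalisation 1/√(2^{n−1}))] -/
theorem two_mul_card_outcomes {bstar : Bits n} (hs0 : bstar ≠ fun _ => false) :
    2 * (outcomes bstar).card = 2 ^ n := by
  classical
  unfold outcomes
  have h := two_mul_card_filter_dotZ_eq bstar (fun _ => false) hs0
  have hset : (univ.filter fun z : Bits n => dotZ z bstar = 0) =
      univ.filter fun z : Bits n => dotZ z bstar = dotZ z (fun _ => false) := by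
    ext z; simp [dotZ_zero_right]
  rw [hset]
  convert h using 2

/-- The outcomes that do NOT exclude the candidate `b` (`z⋅b = 0`: “learn that b* ≠ b” happens on
the complement). [cite: SingkanipaEtAl2025, App. F (definition of X_b)] -/
def survivors (bstar b : Bits n) : Finset (Bits n) := (outcomes bstar).filter fun z => dotZ z b = 0

/-- **Each run excludes a wrong candidate with probability exactly 1/2**: for `b ∉ {0ⁿ, b*}`,
`2 · |{z ∈ outcomes : z⋅b = 0}| = |outcomes|` (“X_b is geometrically distributed:
Pr(X_b = k) = 2^{−k}”). [cite: SingkanipaEtAl2025, App. F (“Pr(X_b = k) = 2^{−k} for k ≥ 1”)] -/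
theorem two_mul_card_survivors {bstar b : Bits n} (hb0 : b ≠ fun _ => false) (hbs : b ≠ bstar) :
    2 * (survivors bstar b).card = (outcomes bstar).card := by
  classical
  obtain ⟨w, hws, hwb⟩ := exists_dotZ_eq b bstar hb0 hbs
  -- the translation z ↦ z ⊕ w maps survivors onto the non-survivors inside `outcomes`
  have hout : ∀ z, bxor z w ∈ outcomes bstar ↔ z ∈ outcomes bstar := by
    intro z
    simp only [outcomes, mem_filter, mem_univ, true_and, dotZ_bxor_left, hws, add_zero]
  have himg : (survivors bstar b).image (fun z => bxor z w) =
      (outcomes bstar).filter fun z => ¬ dotZ z b = 0 := by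
    ext z
    simp only [mem_image, survivors, mem_filter]
    constructor
    · rintro ⟨z', ⟨hz'o, hz'b⟩, rfl⟩
      refine ⟨(hout z').2 hz'o, ?_⟩
      rw [dotZ_bxor_left, hz'b, hwb]
      decide
    · rintro ⟨hzo, hzb⟩
      refine ⟨bxor z w, ⟨(hout z).2 hzo, ?_⟩, bxor_bxor_cancel z w⟩
      rw [dotZ_bxor_left, hwb]
      have h01 : ∀ x : ZMod 2, x = 0 ∨ x = 1 := by decide
      have : dotZ z b = 1 := by
        rcases h01 (dotZ z b) with h | h
        · exact absurd h hzb
        · exact h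
      rw [this]; decide
  have hinj : Set.InjOn (fun z => bxor z w) (survivors bstar b : Set (Bits n)) := by
    intro z _ z' _ h
    have := congrArg (fun t => bxor t w) h
    simpa [bxor_bxor_cancel] using this
  have hcard : (survivors bstar b).card = ((outcomes bstar).filter fun z => ¬ dotZ z b = 0).card := by
    rw [← himg, card_image_of_injOn hinj]
  calc 2 * (survivors bstar b).card
      = (survivors bstar b).card + ((outcomes bstar).filter fun z => ¬ dotZ z b = 0).card := by
        rw [two_mul, ← hcard]
    _ = (outcomes bstar).card := by
        unfold survivors
        convert card_filter_add_card_filter_not (s := outcomes bstar) (fun z => dotZ z b = 0) using 2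

/-! ## `k` runs: `Pr(X_max > k) ≤ (|S| − 1) 2^{−k}` (display (F1), tail form) -/

/-- The sample space of `k` independent runs: `k`-tuples of outcomes (uniform law).
[cite: SingkanipaEtAl2025, App. F (“upon each circuit execution z is uniformly distributed”)] -/
def runs (bstar : Bits n) (k : ℕ) : Finset (Fin k → Bits n) :=
  Fintype.piFinset fun _ => outcomes bstar

/-- `|runs| = |outcomes|^k`. [cite: SingkanipaEtAl2025, App. F] -/
theorem card_runs (bstar : Bits n) (k : ℕ) : (runs bstar k).card = (outcomes bstar).card ^ k :=
  Fintype.card_piFinset_const _ _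

/-- The candidate `b` is still ALIVE after the runs `zs` (`X_b > k`): no outcome has excluded it.
[cite: SingkanipaEtAl2025, App. F (X_b)] -/
def alive (b : Bits n) {k : ℕ} (zs : Fin k → Bits n) : Prop := ∀ j, dotZ (zs j) b = 0

/-- Some wrong candidate is still alive after the runs (`X_max > k`: `b*` is not yet uniquely
determined within `S`). [cite: SingkanipaEtAl2025, App. F (X_max = max_{b∈S*} X_b)] -/
def someAlive (S : Finset (Bits n)) (bstar : Bits n) {k : ℕ} (zs : Fin k → Bits n) : Prop :=
  ∃ b ∈ S.erase bstar, alive b zs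

open scoped Classical

/-- `Pr(X_b > k) = 2^{−k}`: `2^k · |{zs ∈ runs : b alive}| = |runs|` for `b ∉ {0ⁿ, b*}`.
[cite: SingkanipaEtAl2025, App. F (“X_b is geometrically distributed”)] -/
theorem two_pow_mul_card_filter_alive {bstar b : Bits n} (hb0 : b ≠ fun _ => false)
    (hbs : b ≠ bstar) (k : ℕ) :
    2 ^ k * ((runs bstar k).filter fun zs => alive b zs).card = (runs bstar k).card := by
  have hset : ((runs bstar k).filter fun zs => alive b zs) =
      Fintype.piFinset fun _ : Fin k => survivors bstar b := by
    ext zs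
    simp only [runs, mem_filter, Fintype.mem_piFinset, alive, survivors]
    exact ⟨fun ⟨h1, h2⟩ j => ⟨h1 j, h2 j⟩, fun h => ⟨fun j => (h j).1, fun j => (h j).2⟩⟩
  rw [hset, Fintype.card_piFinset_const, card_runs, ← mul_pow, two_mul_card_survivors hb0 hbs]

/-- **Display (F1), tail form**: `Pr(X_max > k) ≤ (|S| − 1)·2^{−k}`, i.e.
`2^k · |{zs ∈ runs : some b ∈ S ∖ {b*} alive}| ≤ (|S| − 1) · |runs|` (union bound over
`S* = S ∖ {b*}`, for a set `S` of nonzero masks containing `b*`).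
[cite: SingkanipaEtAl2025, App. F display (F1) (“Pr(X_max ≥ k) ≤ (|S| − 1)2^{1−k}”)] -/
theorem two_pow_mul_card_filter_someAlive_le (S : Finset (Bits n))
    (h0 : (fun _ => false : Bits n) ∉ S) {bstar : Bits n} (hbS : bstar ∈ S) (k : ℕ) :
    2 ^ k * ((runs bstar k).filter fun zs => someAlive S bstar zs).card ≤
      (S.card - 1) * (runs bstar k).card := by
  calc 2 ^ k * ((runs bstar k).filter fun zs => someAlive S bstar zs).card
      ≤ 2 ^ k * ∑ b ∈ S.erase bstar, ((runs bstar k).filter fun zs => alive b zs).card := by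
        refine Nat.mul_le_mul_left _ ?_
        have hsub : ((runs bstar k).filter fun zs => someAlive S bstar zs) ⊆
            (S.erase bstar).biUnion fun b => (runs bstar k).filter fun zs => alive b zs := by
          intro zs hzs
          rw [mem_filter] at hzs
          obtain ⟨b, hb, hal⟩ := hzs.2
          exact mem_biUnion.2 ⟨b, hb, mem_filter.2 ⟨hzs.1, hal⟩⟩
        exact (card_le_card hsub).trans card_biUnion_le
    _ = ∑ b ∈ S.erase bstar, 2 ^ k * ((runs bstar k).filter fun zs => alive b zs).card := mul_sum _ _ _
    _ = ∑ b ∈ S.erase bstar, (runs bstar k).card := by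
        refine sum_congr rfl fun b hb => ?_
        obtain ⟨hbs, hbS'⟩ := mem_erase.1 hb
        exact two_pow_mul_card_filter_alive (fun h => h0 (h ▸ hbS')) hbs k
    _ = (S.card - 1) * (runs bstar k).card := by rw [sum_const, smul_eq_mul, card_erase_of_mem hbS]

/-! ## The expectation bound (F2): every partial sum of `Σ_k Pr(X_max > k)` is `≤ log₂(|S|−1) + 2` -/

/-- `Pr(X_max > k)` under the uniform law on `k` runs, as a real number.
[cite: SingkanipaEtAl2025, App. F (Pr(X_max ≥ k))] -/
def tailProb (S : Finset (Bits n)) (bstar : Bits n) (k : ℕ) : ℝ :=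
  (((runs bstar k).filter fun zs => someAlive S bstar zs).card : ℝ) / (runs bstar k).card

/-- `|runs| > 0` (each run has at least the outcome `0ⁿ`). [folklore] -/
private theorem card_runs_pos (bstar : Bits n) (k : ℕ) : 0 < (runs bstar k).card := by
  rw [card_runs]
  refine pow_pos (card_pos.2 ⟨fun _ => false, ?_⟩) k
  simp [outcomes, dotZ]

/-- `Pr(X_max > k) ≤ 1` (the `min(1, ·)` in (F2)). [cite: SingkanipaEtAl2025, App. F display (F2) (the summands `min(1, 2^{a+b+1−k})`)] -/
theorem tailProb_le_one (S : Finset (Bits n)) (bstar : Bits n) (k : ℕ) : tailProb S bstar k ≤ 1 := by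
  unfold tailProb
  rw [div_le_one (by exact_mod_cast card_runs_pos bstar k)]
  exact_mod_cast card_filter_le _ _

/-- `Pr(X_max > k) ≤ (|S| − 1) / 2^k` (display (F1)). [cite: SingkanipaEtAl2025, App. F display (F1)] -/
theorem tailProb_le (S : Finset (Bits n)) (h0 : (fun _ => false : Bits n) ∉ S) {bstar : Bits n}
    (hbS : bstar ∈ S) (k : ℕ) : tailProb S bstar k ≤ ((S.card - 1 : ℕ) : ℝ) / 2 ^ k := by
  unfold tailProb
  have hr : (0 : ℝ) < (runs bstar k).card := by exact_mod_cast card_runs_pos bstar k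
  rw [div_le_div_iff₀ hr (by positivity)]
  have h := two_pow_mul_card_filter_someAlive_le S h0 hbS k
  have h' : (((runs bstar k).filter fun zs => someAlive S bstar zs).card : ℝ) * 2 ^ k ≤
      ((S.card - 1 : ℕ) : ℝ) * (runs bstar k).card := by
    rw [mul_comm]
    exact_mod_cast h
  exact h'

/-- **The analytic step of (F2)**: for `m ≥ 1` and every `K`,
`Σ_{k<K} min(1, m·2^{−k}) ≤ log₂ m + 2` — split at `a = ⌊log₂ m⌋`: the first `a + 1` terms are
`≤ 1`, the tail is `≤ m·2^{−a} = 2^b ≤ 1 + b` with `b = log₂ m − a ∈ [0, 1)` (“a + 1 + 2^b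
… ≤ log₂(|S| − 1) + 2”). [cite: SingkanipaEtAl2025, App. F display (F2)] -/
theorem sum_min_one_div_two_pow_le {m : ℕ} (hm : 1 ≤ m) (K : ℕ) :
    ∑ k ∈ range K, min (1 : ℝ) ((m : ℝ) / 2 ^ k) ≤ Real.logb 2 m + 2 := by
  set a := Nat.log 2 m with ha
  have hm0 : m ≠ 0 := by omega
  have h2a : (2 : ℝ) ^ a ≤ m := by exact_mod_cast Nat.pow_log_le_self 2 hm0
  have hm2 : (m : ℝ) < 2 ^ (a + 1) := by exact_mod_cast Nat.lt_pow_succ_log_self one_lt_two m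
  -- termwise bound: 1 for k ≤ a, m/2^k for k > a
  have hterm : ∀ k, min (1 : ℝ) ((m : ℝ) / 2 ^ k) ≤
      (if k < a + 1 then (1 : ℝ) else 0) + (if k < a + 1 then (0 : ℝ) else (m : ℝ) / 2 ^ k) := by
    intro k
    split_ifs with hk
    · simp
    · simp
  have hsplit : ∑ k ∈ range K, min (1 : ℝ) ((m : ℝ) / 2 ^ k) ≤
      ∑ k ∈ range K, (if k < a + 1 then (1 : ℝ) else 0) +
        ∑ k ∈ range K, (if k < a + 1 then (0 : ℝ) else (m : ℝ) / 2 ^ k) := by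
    rw [← sum_add_distrib]
    exact sum_le_sum fun k _ => hterm k
  -- the head: at most a + 1 ones
  have hhead : ∑ k ∈ range K, (if k < a + 1 then (1 : ℝ) else 0) ≤ a + 1 := by
    rw [← sum_filter]
    calc ∑ k ∈ (range K).filter (fun k => k < a + 1), (1 : ℝ)
        = (((range K).filter fun k => k < a + 1).card : ℝ) := by simp
      _ ≤ ((range (a + 1)).card : ℝ) := by
          exact_mod_cast card_le_card fun k hk => by
            rw [mem_filter, mem_range] at hk; exact mem_range.2 hk.2
      _ = a + 1 := by simp
  -- the tail: Σ_{a < k < K} m/2^k ≤ m/2^a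
  have htail : ∑ k ∈ range K, (if k < a + 1 then (0 : ℝ) else (m : ℝ) / 2 ^ k) ≤ (m : ℝ) / 2 ^ a := by
    rw [sum_ite, sum_const_zero, zero_add]
    have hK : ((range K).filter fun k => ¬ k < a + 1) = Ico (a + 1) (max K (a + 1)) := by
      ext k
      simp only [mem_filter, mem_range, not_lt, mem_Ico]
      omega
    rw [hK, sum_Ico_eq_sum_range]
    have hgeom : ∑ j ∈ range (max K (a + 1) - (a + 1)), (m : ℝ) / 2 ^ (a + 1 + j) =
        (m : ℝ) / 2 ^ (a + 1) * ∑ j ∈ range (max K (a + 1) - (a + 1)), ((1 : ℝ) / 2) ^ j := by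
      rw [mul_sum]
      refine sum_congr rfl fun j _ => ?_
      rw [pow_add, one_div, inv_pow]
      field_simp
    rw [hgeom]
    have hg2 : ∑ j ∈ range (max K (a + 1) - (a + 1)), ((1 : ℝ) / 2) ^ j ≤ 2 := by
      rw [geom_sum_eq (by norm_num) _]
      have hp : (0 : ℝ) ≤ ((1 : ℝ) / 2) ^ (max K (a + 1) - (a + 1)) := by positivity
      have : (((1 : ℝ) / 2) ^ (max K (a + 1) - (a + 1)) - 1) / ((1 : ℝ) / 2 - 1) =
          2 * (1 - ((1 : ℝ) / 2) ^ (max K (a + 1) - (a + 1))) := by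
        field_simp
        ring
      rw [this]
      linarith
    calc (m : ℝ) / 2 ^ (a + 1) * ∑ j ∈ range (max K (a + 1) - (a + 1)), ((1 : ℝ) / 2) ^ j
        ≤ (m : ℝ) / 2 ^ (a + 1) * 2 := by
          exact mul_le_mul_of_nonneg_left hg2 (by positivity)
      _ = (m : ℝ) / 2 ^ a := by rw [pow_succ]; field_simp
  -- m / 2^a = 2^β with β = log₂ m − a ∈ [0,1), and 2^β ≤ 1 + β (Bernoulli)
  have hβ0 : (0 : ℝ) ≤ Real.logb 2 m - a := by
    have := Real.natLog_le_logb m 2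
    rw [← ha] at this
    push_cast at this
    linarith
  have hβ1 : Real.logb 2 m - a ≤ 1 := by
    have hlt : Real.logb 2 (m : ℝ) < (a + 1 : ℕ) := by
      rw [Real.logb_lt_iff_lt_rpow one_lt_two (by exact_mod_cast Nat.pos_of_ne_zero hm0)]
      rw [Real.rpow_natCast]
      exact hm2
    push_cast at hlt
    linarith
  have hquot : (m : ℝ) / 2 ^ a = (2 : ℝ) ^ (Real.logb 2 m - a) := by
    rw [Real.rpow_sub two_pos, Real.rpow_logb two_pos (by norm_num)
      (by exact_mod_cast Nat.pos_of_ne_zero hm0), Real.rpow_natCast]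
  have hbern : (2 : ℝ) ^ (Real.logb 2 m - a) ≤ 1 + (Real.logb 2 m - a) := by
    have := rpow_one_add_le_one_add_mul_self (show (-1 : ℝ) ≤ 1 by norm_num) hβ0 hβ1
    norm_num at this
    linarith [this]
  calc ∑ k ∈ range K, min (1 : ℝ) ((m : ℝ) / 2 ^ k)
      ≤ (a + 1 : ℝ) + (m : ℝ) / 2 ^ a := hsplit.trans (add_le_add hhead htail)
    _ ≤ (a + 1 : ℝ) + (1 + (Real.logb 2 m - a)) := by rw [hquot]; linarith [hbern]
    _ = Real.logb 2 m + 2 := by ring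

/-- **Theorem 2, upper bound (eq. (6)), in tail-sum form**: for a set `S` of nonzero candidate
masks with `|S| ≥ 2` containing the true mask `b*`, and every horizon `K`,
`Σ_{k<K} Pr(X_max > k) ≤ log₂(|S| − 1) + 2`.  Since `NTS_IQ = E[X_max] = Σ_{k≥0} Pr(X_max > k)`
(App. F: “NTS_IQ = E[X_max] = Σ_{k=1}^{∞} Pr(X_max ≥ k)”), the ideal quantum player's expected
number of runs is at most `log₂(|S| − 1) + 2`. [cite: SingkanipaEtAl2025, Theorem 2 eq. (6) (upper bound) and App. F (F1)–(F2)] -/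
theorem sum_tailProb_le (S : Finset (Bits n)) (h0 : (fun _ => false : Bits n) ∉ S)
    {bstar : Bits n} (hbS : bstar ∈ S) (hS : 2 ≤ S.card) (K : ℕ) :
    ∑ k ∈ range K, tailProb S bstar k ≤ Real.logb 2 ((S.card - 1 : ℕ) : ℝ) + 2 := by
  calc ∑ k ∈ range K, tailProb S bstar k
      ≤ ∑ k ∈ range K, min (1 : ℝ) ((((S.card - 1 : ℕ) : ℝ)) / 2 ^ k) :=
        sum_le_sum fun k _ => le_min (tailProb_le_one S bstar k) (tailProb_le S h0 hbS k)
    _ ≤ Real.logb 2 ((S.card - 1 : ℕ) : ℝ) + 2 := sum_min_one_div_two_pow_le (by omega) K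

/-- **Theorem 2 (upper bound) for wwSimon-n**: with `S` the admissible masks
(`|S| = N_w = Σ_{j=1}^{w} C(n,j)`), every partial sum of `Σ_k Pr(X_max > k)` is at most
`log₂(N_w − 1) + 2`. [cite: SingkanipaEtAl2025, Theorem 2 eq. (6)] -/
theorem sum_tailProb_admissible_le {w : ℕ} {bstar : Bits n} (hbS : bstar ∈ admissible n w)
    (hS : 2 ≤ ∑ j ∈ Icc 1 w, n.choose j) (K : ℕ) :
    ∑ k ∈ range K, tailProb (admissible n w) bstar k ≤
      Real.logb 2 (((∑ j ∈ Icc 1 w, n.choose j) - 1 : ℕ) : ℝ) + 2 := by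
  rw [← card_admissible] at hS ⊢
  exact sum_tailProb_le _ (zero_notMem_admissible n w) hbS hS K

end SimonLB

end Literature.Computability.QuantumComplexity
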